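import Mathlib
import HarnessLib
import Summits.NavierStokesRegularity.NavierStokesRegularity.Theorems.PoloidalWindowDoorPoloidalWindowRigidityZShockHodographDarboux
import Summits.NavierStokesRegularity.NavierStokesRegularity.Theorems.PoloidalWindowDoorPoloidalWindowRigidityZShockHodographHump
import Summits.NavierStokesRegularity.NavierStokesRegularity.Theorems.PoloidalWindowDoorPoloidalWindowRigidityZShockHodographJacobian
import Summits.NavierStokesRegularity.NavierStokesRegularity.Theorems.PoloidalWindowDoorPoloidalWindowRigidityZShockHodographSegment

/-!
# Crux K2 `PoloidalWindowRigidity` (stmt-NavierStokesRegularity-19708), line `z_shock` — NEGATIVE KERNEL BRICK 5b for the class-free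
# slice Liouville `hGN`: ★ GLOBAL INJECTIVITY of the hump two-wave map

`--supports stmt-NavierStokesRegularity-19708 --as helper` (leafhand-ns-poloidalwindowdoor-3 g34, cell decomp-ns, 2026-09-01).
Class-free, def-free; Mathlib + `…HodographSegment` (brick 5a) and bricks 1–3.  **No stub and no summit is closed by this file;
Navier–Stokes regularity is NOT proved here (rung 0).**  Evidence memo `HGN-COUNTEREXAMPLE-leafhand3-g34.md` §3.

`hump_injective` — the Darboux–hodograph map `(r,s) ↦ (τ, ξ)` with the HUMP speed `k = (1 − ρ tanh ρ)²` and data `f = g = artanh(·/m)`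
(`F` its log-primitive, `𝔽` ANY primitive of `F`) is INJECTIVE on the open square `|r|, |s| < m`, `0 < m ≤ 1/2`: along the segment
between two points, `τ` is strictly monotone when `Δr·Δs ≤ 0` and `ξ` is strictly monotone when `Δr·Δs ≥ 0` (sign structure
`τ_r > 0 > τ_s`, `ξ_r = −ψ²τ_r < 0`, `ξ_s = ψ²τ_s < 0` from bricks 2–3; `strictMonoOn_of_deriv_pos` on `[0,1]`).  Together with the local
diffeomorphism property (brick 3) and properness (memo, elementary) the map is a real-analytic diffeomorphism of the square onto `ℝ²`,
whose inverse is the bounded eternal two-wave solution inhabiting `hGN` after the oblique lift (brick 4). [folklore]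
-/

noncomputable section

namespace Summit.NavierStokesRegularity.NavierStokesRegularity.Theorems.PoloidalWindowDoorPoloidalWindowRigidityZShockHodographInverse

-- the problem directory repeats the summit name (`NavierStokesRegularity/NavierStokesRegularity`)
set_option linter.dupNamespace false

open Real Set
open Summit.NavierStokesRegularity.NavierStokesRegularity.Theorems.PoloidalWindowDoorPoloidalWindowRigidityZShockHodographSegment

/-- Sign bookkeeping (region `Δr ≥ 0`, `Δs ≥ 0`). [folklore] -/
theorem sign_aux_C (Zr Zs ψv Δr Δs : ℝ) (hZr : 0 < Zr) (hZs : Zs < 0) (hψ : 0 < ψv) (hr : 0 ≤ Δr) (hs : 0 ≤ Δs)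
    (hne : ¬Δr = 0 ∨ ¬Δs = 0) : -ψv ^ 2 * Zr * Δr + ψv ^ 2 * Zs * Δs < 0 := by
  have hψ2 : 0 < ψv ^ 2 := by positivity
  rcases hne with h | h
  · have : 0 < Δr := lt_of_le_of_ne hr (Ne.symm h)
    nlinarith [mul_pos (mul_pos hψ2 hZr) this, mul_nonneg (mul_pos hψ2 (neg_pos.mpr hZs)).le hs]
  · have : 0 < Δs := lt_of_le_of_ne hs (Ne.symm h)
    nlinarith [mul_nonneg (mul_pos hψ2 hZr).le hr, mul_pos (mul_pos hψ2 (neg_pos.mpr hZs)) this]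

/-- Sign bookkeeping (region `Δr ≥ 0`, `Δs ≤ 0`). [folklore] -/
theorem sign_aux_A (Zr Zs Δr Δs : ℝ) (hZr : 0 < Zr) (hZs : Zs < 0) (hr : 0 ≤ Δr) (hs : Δs ≤ 0)
    (hne : ¬Δr = 0 ∨ ¬Δs = 0) : 0 < Zr * Δr + Zs * Δs := by
  rcases hne with h | h
  · have : 0 < Δr := lt_of_le_of_ne hr (Ne.symm h)
    nlinarith [mul_pos hZr this, mul_nonneg (neg_pos.mpr hZs).le (neg_nonneg.mpr hs)]
  · have : Δs < 0 := lt_of_le_of_ne hs h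
    nlinarith [mul_nonneg hZr.le hr, mul_pos (neg_pos.mpr hZs) (neg_pos.mpr this)]

/-- Sign bookkeeping (region `Δr ≤ 0`, `Δs ≥ 0`). [folklore] -/
theorem sign_aux_B (Zr Zs Δr Δs : ℝ) (hZr : 0 < Zr) (hZs : Zs < 0) (hr : Δr ≤ 0) (hs : 0 ≤ Δs)
    (hne : ¬Δr = 0 ∨ ¬Δs = 0) : Zr * Δr + Zs * Δs < 0 := by
  rcases hne with h | h
  · have : Δr < 0 := lt_of_le_of_ne hr h
    nlinarith [mul_pos hZr (neg_pos.mpr this), mul_nonneg (neg_pos.mpr hZs).le hs]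
  · have : 0 < Δs := lt_of_le_of_ne hs (Ne.symm h)
    nlinarith [mul_nonneg hZr.le (neg_nonneg.mpr hr), mul_pos (neg_pos.mpr hZs) this]

/-- Sign bookkeeping (region `Δr ≤ 0`, `Δs ≤ 0`). [folklore] -/
theorem sign_aux_D (Zr Zs ψv Δr Δs : ℝ) (hZr : 0 < Zr) (hZs : Zs < 0) (hψ : 0 < ψv) (hr : Δr ≤ 0) (hs : Δs ≤ 0)
    (hne : ¬Δr = 0 ∨ ¬Δs = 0) : 0 < -ψv ^ 2 * Zr * Δr + ψv ^ 2 * Zs * Δs := by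
  have hψ2 : 0 < ψv ^ 2 := by positivity
  rcases hne with h | h
  · have : Δr < 0 := lt_of_le_of_ne hr h
    nlinarith [mul_pos (mul_pos hψ2 hZr) (neg_pos.mpr this),
      mul_nonneg (mul_pos hψ2 (neg_pos.mpr hZs)).le (neg_nonneg.mpr hs)]
  · have : Δs < 0 := lt_of_le_of_ne hs h
    nlinarith [mul_nonneg (mul_pos hψ2 hZr).le (neg_nonneg.mpr hr),
      mul_pos (mul_pos hψ2 (neg_pos.mpr hZs)) (neg_pos.mpr this)]

set_option maxHeartbeats 400000 in
/-- ★ **GLOBAL INJECTIVITY of the hump two-wave map** on the open square `|r|, |s| < m`, `0 < m ≤ 1/2` (memo §3): if the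
Darboux–hodograph pair `(τ, ξ)` (hump speed, data `f = artanh(·/m)`, `F` its log-primitive, `𝔽` ANY primitive of `F`) takes the
same value at `(r₁, s₁)` and `(r₁ + Δr, s₁ + Δs)`, then `Δr = Δs = 0`.  Proof: along the segment `τ` is strictly monotone when
`Δr·Δs ≤ 0` and `ξ` is strictly monotone when `Δr·Δs ≥ 0` (`τ_r > 0 > τ_s`, `ξ_r, ξ_s < 0`; `segment_point`,
`strictMonoOn_of_deriv_pos`). [folklore] -/
theorem hump_injective (m : ℝ) (hm : 0 < m) (hm' : m ≤ 1 / 2) (𝔽 : ℝ → ℝ)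
    (h𝔽 : ∀ t, |t| < m → HasDerivAt 𝔽
      (m / 2 * ((1 + t / m) * Real.log (1 + t / m) + (1 - t / m) * Real.log (1 - t / m))) t)
    (r₁ s₁ Δr Δs : ℝ) (hr₁ : |r₁| < m) (hs₁ : |s₁| < m) (hr₂ : |r₁ + Δr| < m) (hs₂ : |s₁ + Δs| < m)
    (hτ : ((Real.artanh ((r₁) / m) - Real.artanh ((s₁) / m) - Real.tanh (((r₁) - (s₁)) / 2) * ((m / 2 * ((1 + (r₁) / m) * Real.log (1 + (r₁) / m) + (1 - (r₁) / m) * Real.log (1 - (r₁) / m))) + (m / 2 * ((1 + (s₁) / m) * Real.log (1 + (s₁) / m) + (1 - (s₁) / m) * Real.log (1 - (s₁) / m))))) / (1 - ((r₁) - (s₁)) / 2 * Real.tanh (((r₁) - (s₁)) / 2))) =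
      ((Real.artanh ((r₁ + Δr) / m) - Real.artanh ((s₁ + Δs) / m) - Real.tanh (((r₁ + Δr) - (s₁ + Δs)) / 2) * ((m / 2 * ((1 + (r₁ + Δr) / m) * Real.log (1 + (r₁ + Δr) / m) + (1 - (r₁ + Δr) / m) * Real.log (1 - (r₁ + Δr) / m))) + (m / 2 * ((1 + (s₁ + Δs) / m) * Real.log (1 + (s₁ + Δs) / m) + (1 - (s₁ + Δs) / m) * Real.log (1 - (s₁ + Δs) / m))))) / (1 - ((r₁ + Δr) - (s₁ + Δs)) / 2 * Real.tanh (((r₁ + Δr) - (s₁ + Δs)) / 2))))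
    (hξ : (-(1 - ((r₁) - (s₁)) / 2 * Real.tanh (((r₁) - (s₁)) / 2)) * (Real.artanh ((r₁) / m) + Real.artanh ((s₁) / m)) - ((r₁) - (s₁)) / 2 * ((m / 2 * ((1 + (r₁) / m) * Real.log (1 + (r₁) / m) + (1 - (r₁) / m) * Real.log (1 - (r₁) / m))) - (m / 2 * ((1 + (s₁) / m) * Real.log (1 + (s₁) / m) + (1 - (s₁) / m) * Real.log (1 - (s₁) / m)))) + (𝔽 (r₁) + 𝔽 (s₁))) =
      (-(1 - ((r₁ + Δr) - (s₁ + Δs)) / 2 * Real.tanh (((r₁ + Δr) - (s₁ + Δs)) / 2)) * (Real.artanh ((r₁ + Δr) / m) + Real.artanh ((s₁ + Δs) / m)) - ((r₁ + Δr) - (s₁ + Δs)) / 2 * ((m / 2 * ((1 + (r₁ + Δr) / m) * Real.log (1 + (r₁ + Δr) / m) + (1 - (r₁ + Δr) / m) * Real.log (1 - (r₁ + Δr) / m))) - (m / 2 * ((1 + (s₁ + Δs) / m) * Real.log (1 + (s₁ + Δs) / m) + (1 - (s₁ + Δs) / m) * Real.log (1 - (s₁ + Δs) / m)))) + (𝔽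 (r₁ + Δr) + 𝔽 (s₁ + Δs)))) :
    Δr = 0 ∧ Δs = 0 := by
  set G : ℝ → ℝ := fun t' => ((Real.artanh ((r₁ + t' * Δr) / m) - Real.artanh ((s₁ + t' * Δs) / m) - Real.tanh (((r₁ + t' * Δr) - (s₁ + t' * Δs)) / 2) * ((m / 2 * ((1 + (r₁ + t' * Δr) / m) * Real.log (1 + (r₁ + t' * Δr) / m) + (1 - (r₁ + t' * Δr) / m) * Real.log (1 - (r₁ + t' * Δr) / m))) + (m / 2 * ((1 + (s₁ + t' * Δs) / m) * Real.log (1 + (s₁ + t' * Δs) / m) + (1 - (s₁ + t' * Δs) / m) * Real.log (1 - (s₁ + t' * Δs) / m))))) / (1 - ((r₁ + t' * Δr) - (s₁ + t' * Δs)) / 2 * Real.tanh (((r₁ + t' * Δr) - (s₁ + t' * Δs)) / 2))) with hG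
  set H : ℝ → ℝ := fun t' => (-(1 - ((r₁ + t' * Δr) - (s₁ + t' * Δs)) / 2 * Real.tanh (((r₁ + t' * Δr) - (s₁ + t' * Δs)) / 2)) * (Real.artanh ((r₁ + t' * Δr) / m) + Real.artanh ((s₁ + t' * Δs) / m)) - ((r₁ + t' * Δr) - (s₁ + t' * Δs)) / 2 * ((m / 2 * ((1 + (r₁ + t' * Δr) / m) * Real.log (1 + (r₁ + t' * Δr) / m) + (1 - (r₁ + t' * Δr) / m) * Real.log (1 - (r₁ + t' * Δr) / m))) - (m / 2 * ((1 + (s₁ + t' * Δs) / m) * Real.log (1 + (s₁ + t' * Δs) / m) + (1 - (s₁ + t' * Δs) / m) * Real.log (1 - (s₁ + t' * Δs) / m)))) + (𝔽 (r₁ + t' * Δr) + 𝔽 (s₁ + t' * Δs))) with hH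
  have hG0 : G 0 = ((Real.artanh ((r₁) / m) - Real.artanh ((s₁) / m) - Real.tanh (((r₁) - (s₁)) / 2) * ((m / 2 * ((1 + (r₁) / m) * Real.log (1 + (r₁) / m) + (1 - (r₁) / m) * Real.log (1 - (r₁) / m))) + (m / 2 * ((1 + (s₁) / m) * Real.log (1 + (s₁) / m) + (1 - (s₁) / m) * Real.log (1 - (s₁) / m))))) / (1 - ((r₁) - (s₁)) / 2 * Real.tanh (((r₁) - (s₁)) / 2))) := by
    simp only [hG, zero_mul, add_zero]
  have hG1 : G 1 = ((Real.artanh ((r₁ + Δr) / m) - Real.artanh ((s₁ + Δs) / m) - Real.tanh (((r₁ + Δr) - (s₁ + Δs)) / 2) * ((m / 2 * ((1 + (r₁ + Δr) / m) * Real.log (1 + (r₁ + Δr) / m) + (1 - (r₁ + Δr) / m) * Real.log (1 - (r₁ + Δr) / m))) + (m / 2 * ((1 + (s₁ + Δs) / m) * Real.log (1 + (s₁ + Δs) / m) + (1 - (s₁ + Δs) / m) * Real.log (1 - (s₁ + Δs) / m))))) / (1 - ((r₁ + Δr) - (s₁ + Δs)) / 2 * Real.tanh (((r₁ + Δr) -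 (s₁ + Δs)) / 2))) := by
    simp only [hG, one_mul]
  have hH0 : H 0 = (-(1 - ((r₁) - (s₁)) / 2 * Real.tanh (((r₁) - (s₁)) / 2)) * (Real.artanh ((r₁) / m) + Real.artanh ((s₁) / m)) - ((r₁) - (s₁)) / 2 * ((m / 2 * ((1 + (r₁) / m) * Real.log (1 + (r₁) / m) + (1 - (r₁) / m) * Real.log (1 - (r₁) / m))) - (m / 2 * ((1 + (s₁) / m) * Real.log (1 + (s₁) / m) + (1 - (s₁) / m) * Real.log (1 - (s₁) / m)))) + (𝔽 (r₁) + 𝔽 (s₁))) := by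
    simp only [hH, zero_mul, add_zero]
  have hH1 : H 1 = (-(1 - ((r₁ + Δr) - (s₁ + Δs)) / 2 * Real.tanh (((r₁ + Δr) - (s₁ + Δs)) / 2)) * (Real.artanh ((r₁ + Δr) / m) + Real.artanh ((s₁ + Δs) / m)) - ((r₁ + Δr) - (s₁ + Δs)) / 2 * ((m / 2 * ((1 + (r₁ + Δr) / m) * Real.log (1 + (r₁ + Δr) / m) + (1 - (r₁ + Δr) / m) * Real.log (1 - (r₁ + Δr) / m))) - (m / 2 * ((1 + (s₁ + Δs) / m) * Real.log (1 + (s₁ + Δs) / m) + (1 - (s₁ + Δs) / m) * Real.log (1 - (s₁ + Δs) / m)))) + (𝔽 (r₁ + Δr) + 𝔽 (s₁ + Δs))) := by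
    simp only [hH, one_mul]
  have hGeq : G 0 = G 1 := by rw [hG0, hG1]; exact hτ
  have hHeq : H 0 = H 1 := by rw [hH0, hH1]; exact hξ
  -- the segment stays in the square
  have hseg : ∀ t ∈ Set.Icc (0:ℝ) 1, |r₁ + t * Δr| < m ∧ |s₁ + t * Δs| < m := by
    intro t ht
    have e1 : r₁ + t * Δr = r₁ + t * ((r₁ + Δr) - r₁) := by ring
    have e2 : s₁ + t * Δs = s₁ + t * ((s₁ + Δs) - s₁) := by ring
    rw [e1, e2]
    exact ⟨abs_segment_lt hr₁ hr₂ ht.1 ht.2, abs_segment_lt hs₁ hs₂ ht.1 ht.2⟩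
  -- pointwise derivative data
  have hpt : ∀ t ∈ Set.Icc (0:ℝ) 1, ∃ Zr Zs ψv : ℝ, 0 < Zr ∧ Zs < 0 ∧ 0 < ψv ∧
      HasDerivAt G (Zr * Δr + Zs * Δs) t ∧ HasDerivAt H (-ψv ^ 2 * Zr * Δr + ψv ^ 2 * Zs * Δs) t := by
    intro t ht
    obtain ⟨hr, hs⟩ := hseg t ht
    exact segment_point m hm hm' 𝔽 h𝔽 r₁ s₁ Δr Δs t hr hs
  have hGc : ContinuousOn G (Set.Icc 0 1) := fun t ht => by
    obtain ⟨Zr, Zs, ψv, -, -, -, hd, -⟩ := hpt t ht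
    exact hd.continuousAt.continuousWithinAt
  have hHc : ContinuousOn H (Set.Icc 0 1) := fun t ht => by
    obtain ⟨Zr, Zs, ψv, -, -, -, -, hd⟩ := hpt t ht
    exact hd.continuousAt.continuousWithinAt
  have h01 : (0:ℝ) ∈ Set.Icc (0:ℝ) 1 := ⟨le_rfl, zero_le_one⟩
  have h11 : (1:ℝ) ∈ Set.Icc (0:ℝ) 1 := ⟨zero_le_one, le_rfl⟩
  by_contra hne
  rw [not_and_or] at hne
  rcases le_total 0 Δr with hΔr | hΔr <;> rcases le_total 0 Δs with hΔs | hΔs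
  · -- (C) Δr ≥ 0, Δs ≥ 0: H strictly decreasing
    have hanti : StrictAntiOn H (Set.Icc 0 1) := by
      refine strictAntiOn_of_deriv_neg (convex_Icc 0 1) hHc fun t ht => ?_
      rw [interior_Icc] at ht
      obtain ⟨Zr, Zs, ψv, hZr, hZs, hψv, -, hd⟩ := hpt t ⟨ht.1.le, ht.2.le⟩
      rw [hd.deriv]
      exact sign_aux_C Zr Zs ψv Δr Δs hZr hZs hψv hΔr hΔs hne
    have := hanti h01 h11 zero_lt_one
    rw [hHeq] at this; exact lt_irrefl _ this
  · -- (A) Δr ≥ 0, Δs ≤ 0: G strictly increasing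
    have hmono : StrictMonoOn G (Set.Icc 0 1) := by
      refine strictMonoOn_of_deriv_pos (convex_Icc 0 1) hGc fun t ht => ?_
      rw [interior_Icc] at ht
      obtain ⟨Zr, Zs, ψv, hZr, hZs, hψv, hd, -⟩ := hpt t ⟨ht.1.le, ht.2.le⟩
      rw [hd.deriv]
      exact sign_aux_A Zr Zs Δr Δs hZr hZs hΔr hΔs hne
    have := hmono h01 h11 zero_lt_one
    rw [hGeq] at this; exact lt_irrefl _ this
  · -- (B) Δr ≤ 0, Δs ≥ 0: G strictly decreasing
    have hanti : StrictAntiOn G (Set.Icc 0 1) := by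
      refine strictAntiOn_of_deriv_neg (convex_Icc 0 1) hGc fun t ht => ?_
      rw [interior_Icc] at ht
      obtain ⟨Zr, Zs, ψv, hZr, hZs, hψv, hd, -⟩ := hpt t ⟨ht.1.le, ht.2.le⟩
      rw [hd.deriv]
      exact sign_aux_B Zr Zs Δr Δs hZr hZs hΔr hΔs hne
    have := hanti h01 h11 zero_lt_one
    rw [hGeq] at this; exact lt_irrefl _ this
  · -- (D) Δr ≤ 0, Δs ≤ 0: H strictly increasing
    have hmono : StrictMonoOn H (Set.Icc 0 1) := by
      refine strictMonoOn_of_deriv_pos (convex_Icc 0 1) hHc fun t ht => ?_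
      rw [interior_Icc] at ht
      obtain ⟨Zr, Zs, ψv, hZr, hZs, hψv, -, hd⟩ := hpt t ⟨ht.1.le, ht.2.le⟩
      rw [hd.deriv]
      exact sign_aux_D Zr Zs ψv Δr Δs hZr hZs hψv hΔr hΔs hne
    have := hmono h01 h11 zero_lt_one
    rw [hHeq] at this; exact lt_irrefl _ this

end Summit.NavierStokesRegularity.NavierStokesRegularity.Theorems.PoloidalWindowDoorPoloidalWindowRigidityZShockHodographInverse
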